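import Mathlib
import HarnessLib
import Summits.HubbardSuperconductivity.HubbardSuperconductivity.Theorems.KLProgrammeKLRegimeEngineTowerRemeasureSplitKlEng
import Summits.HubbardSuperconductivity.HubbardSuperconductivity.Theorems.KLProgrammeH10TwoPointLimitKlAnisoOffUmklappCountWindow

/-!
# Route `KLProgramme` — crux K3 ENGINE (stmt-HubbardSuperconductivity-20437 `KLRegimeEngineV17F2`), stub (b) v2, THE LEVELS PACKAGE (ℓ):
# instantiation (I2), THE JUMP HALF — THE UMKLAPP SPLIT WITH BOTH COUNTS DISCHARGED (the kit's `c₁`-row / `c₃`-row shape)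
# (E1-LEVELS-BLUEPRINT-g8 §3 (I2); located note «(I2)-M3-FLAT»; cell gate-hubbard-kl, seat hubbard-kl-k3c2-p3 g10)

`…EngineTowerRemeasureSplit[KlEng]` (p589586/p591010) give the split jump at abstract counts.  Here the class is p4's UMKLAPP-ACTIVE class of coarse label tuples
(those `σ′` for which some nonzero reciprocal vector `G` violates the keyed inequality `(m+1)·C·w_k < |Σ_i ±k_F(θ_{k,σ′ i}) − 2πG|`, written out as a `Finset.filter`)
and BOTH counts are discharged: OFF the class by p4 g12's `PerturbedFermiCurve.card_relCount_prescribed_offUmklapp_klAniso_le_window` (a SECOND leg determined: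
`D₁^{m+1}·2^{(J′−k)((m+1)−3)}`, BGM 2006 Lemma A3.1; needs a prescribed leg `p ∈ E`, `m + 1 ≥ 4`, `k ≥ k₀`), ON the class by p4 g11's
`card_relCount_prescribed_lastLeg_klAniso_le_window` (one leg determined).

* §1 **`klLevNormOf_jump_le_split_of_consts_pinned`** — the levelled split brick with the norm's pinned leg `p ∈ E` exposed to the count hypotheses
  (same proof as `klLevNormOf_jump_le_split_of_consts`);
* §2 `offClass_count_arith` (`27^{|E|}·D^{m+1}·2^{Δ((m+1)−3)} ≤ 27^{F+1}·D^{m+1}·(2^Δ)^{m−2}` for `|E| ≤ F+1`);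
* §3 **`klLevNormOf_jump_le_umklappSplit_klEng m (hm : 3 ≤ m)`** — `∃ C_m C D₁ D₂ > 0, ∃ k₀, ∀ R (R.WF2), ∃ c₃ U₀ > 0`, then under the stub binders + `c ≤ c₃`,
  `U ≤ U₀`, `k₀ ≤ k`, `k + 1 ≤ J′ ≤ nScales β + 1`, for momentum-conserving `T`:
  `klLevNormOf … J′ (m+1) T Ωe ≤ C_m·(27^{F+1}·D₁^{m+1}·(2^{J′−k})^{m−2}·N + D₂·27^{m+1}·(2^{J′−k})^{m−F}·N_B)`, `F = levelCount Ωe`, `N` = coarse levelled norms of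
  level `F`, `N_B` = coarse ON-CLASS norms of level `F` — dimensionless (units `2^{(3p−5)Δ}`, `2p = m+1`): off-class `2^{−Δ(p−2)}` = the kit's `c₁`-row (geometric at
  `p = 3`), on-class `(2^Δ)^{m−F}` against the on-class born sizes = the `c₃`/`b₂`-row;
* §4 **`klWtPinnedSumAt_jump_le_umklappSplit_klEng_flow_deep dd m (hm : 3 ≤ m)`** — the weighted twin at the flow frame on p3's deep window:
  `≤ C_m·(27·D₁^{m+1}·(2^{J′−k})^{m−2}·N + D₂·27^{m+1}·(2^{J′−k})^{m−1}·N_B)`.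
Everything is proved; no definitions; nothing about the model is asserted; nothing asserts superconductivity.
References: BGM 2006 §2.8 (2.82)–(2.84), (2.88)–(2.90), App. A3 Lemma A3.1 [cite: BenfattoGiulianiMastropietro2006].
-/

noncomputable section

namespace Summit.HubbardSuperconductivity.HubbardSuperconductivity.Theorems.EngineV8

set_option linter.dupNamespace false -- summit = problem name (single-conjunct summit), D-0017

open Classical
open Real Finset Literature.MathematicalPhysics.QuantumLattice Literature.Probability.LatticeModels GrassmannAlgebra
open Literature.MathematicalPhysics.QuantumLattice.FermiRG
open Summit.HubbardSuperconductivity.HubbardSuperconductivity.Theorems.KLRegimeSplit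
open Summit.HubbardSuperconductivity.HubbardSuperconductivity.Theorems.KLProgrammeLegKernels
open Summit.HubbardSuperconductivity.HubbardSuperconductivity.Theorems.DispersionFlow
open Summit.HubbardSuperconductivity.HubbardSuperconductivity.Theorems.KLRegimeWick
open Summit.HubbardSuperconductivity.HubbardSuperconductivity.Theorems.TorusFourierL2
open Summit.HubbardSuperconductivity.HubbardSuperconductivity.Theorems.PerturbedFermiCurve

variable {L M : ℕ} [NeZero L] [NeZero M]

/-! ## §1 The levelled split brick with the pinned leg exposed -/

/-- **THE LEVELLED JUMP, SPLIT FORM, at abstract constants, with the norm's PINNED LEG EXPOSED to the counts** — as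
`klLevNormOf_jump_le_split_of_consts` (same proof), but the count hypotheses `hRoff`/`hRon` receive a leg `p ∈ E` (the leg set the norm reads always contains its
pinned leg), which p4's off-class count needs. [cite: BenfattoGiulianiMastropietro2006, §2.8 (2.82)-(2.84), (2.88)-(2.90), App. A3] -/
theorem klLevNormOf_jump_le_split_of_consts_pinned {β : ℝ} (hβ : 0 < β) (μ : ℝ) (K : TrigPolyC4v) {k J' : ℕ} (hJ : k + 1 ≤ J')
    (T : HubbardGrassmann L M)
    (hT : ∀ (m : ℕ) (X : Fin m → HubbardFieldIdx L M), ∑ i, signedMomentum L (X i).2 (X i).1.1.2 ≠ 0 → kernel ℂ T m X = 0)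
    {c₁ c₁r : ℝ} (hc₁0 : 0 ≤ c₁) (hc₁r0 : 0 ≤ c₁r)
    (hcol₁ : ∀ (ω'' : Fin (sectorCount J')) (ω' : Fin (sectorCount k)) (σ c : Fin 2) (x' : SpaceTimeIdx L M),
      ∑ x'' : SpaceTimeIdx L M, ‖(sectorAnalysisMatrix L M β (klAnisoFamily L M β μ K klE0 J') *
        sectorSubMatrix L M β (bgmFatMultiplier L M klE0 β (nambuXiCT L μ K) k)) (x'', ((ω'', σ), c)) (x', ((ω', σ), c))‖ ≤ c₁)
    (hrow₁ : ∀ (ω'' : Fin (sectorCount J')) (ω' : Fin (sectorCount k)) (σ c : Fin 2) (x'' : SpaceTimeIdx L M),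
      ∑ x' : SpaceTimeIdx L M, ‖(sectorAnalysisMatrix L M β (klAnisoFamily L M β μ K klE0 J') *
        sectorSubMatrix L M β (bgmFatMultiplier L M klE0 β (nambuXiCT L μ K) k)) (x'', ((ω'', σ), c)) (x', ((ω', σ), c))‖ ≤ c₁r)
    (m : ℕ) (B : Finset (Fin (m + 1) → SectorLeg (sectorCount k))) (Ωe : Fin (m + 1) → Option (SectorLeg (sectorCount J')))
    {A₁ A₂ N NB : ℝ} (hA₁ : 0 ≤ A₁) (hA₂ : 0 ≤ A₂) (hN0 : 0 ≤ N) (hNB0 : 0 ≤ NB)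
    (hRoff : ∀ (E : Finset (Fin (m + 1))) (τ'' : Fin (m + 1) → SectorLeg (sectorCount J')) (σ' : Fin (m + 1) → SectorLeg (sectorCount k))
      (p : Fin (m + 1)), p ∈ E → σ' ∉ B → levelCount Ωe ≤ E.card → E.card ≤ levelCount Ωe + 1 →
      (27 : ℝ) ^ E.card * ((((bgmSectorSet L M (klAnisoFamily L M β μ K klE0 J') (m + 1)).filter fun σ'' => (∀ e ∈ E, σ'' e = τ'' e) ∧ ∀ i,
        (∃ q : FreqMomentum L M, klAnisoFamily L M β μ K klE0 J' (σ'' i).1.1 q ≠ 0 ∧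
          bgmFatMultiplier L M klE0 β (nambuXiCT L μ K) k (σ' i).1.1 q ≠ 0) ∧
        (σ' i).1.2 = (σ'' i).1.2 ∧ (σ' i).2 = (σ'' i).2).card : ℝ)) ≤ A₁)
    (hRon : ∀ (E : Finset (Fin (m + 1))) (τ'' : Fin (m + 1) → SectorLeg (sectorCount J')) (σ' : Fin (m + 1) → SectorLeg (sectorCount k))
      (p : Fin (m + 1)), p ∈ E → σ' ∈ B → levelCount Ωe ≤ E.card → E.card ≤ levelCount Ωe + 1 →
      (27 : ℝ) ^ E.card * ((((bgmSectorSet L M (klAnisoFamily L M β μ K klE0 J') (m + 1)).filter fun σ'' => (∀ e ∈ E, σ'' e = τ'' e) ∧ ∀ i,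
        (∃ q : FreqMomentum L M, klAnisoFamily L M β μ K klE0 J' (σ'' i).1.1 q ≠ 0 ∧
          bgmFatMultiplier L M klE0 β (nambuXiCT L μ K) k (σ' i).1.1 q ≠ 0) ∧
        (σ' i).1.2 = (σ'' i).1.2 ∧ (σ' i).2 = (σ'' i).2).card : ℝ)) ≤ A₂)
    (hN : ∀ Ωe' : Fin (m + 1) → Option (SectorLeg (sectorCount k)), levelCount Ωe' = levelCount Ωe →
      klLevNormOf L M β μ K k (m + 1) T Ωe' ≤ N)
    (hNB : ∀ Ωe' : Fin (m + 1) → Option (SectorLeg (sectorCount k)), levelCount Ωe' = levelCount Ωe →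
      hubbardSectorKernelNorm L M β (klAnisoFamily L M β μ K klE0 k) (prescribedTuples B Ωe') T ≤ NB) :
    klLevNormOf L M β μ K J' (m + 1) T Ωe ≤ c₁ ^ m * c₁r * imagTimeWeight β M ^ (m + 1) * (A₁ * N + A₂ * NB) := by
  have hε0 : 0 ≤ imagTimeWeight β M := imagTimeWeight_nonneg hβ.le M
  set ε := imagTimeWeight β M with hεdef
  set F' := klAnisoFamily L M β μ K klE0 J' with hF'
  set Fk := klAnisoFamily L M β μ K klE0 k with hFk
  have hC : 0 ≤ c₁ ^ m * c₁r * ε ^ (m + 1) * (A₁ * N + A₂ * NB) := by positivity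
  rw [klLevNormOf, hubbardSectorKernelNorm_def]
  refine sectorisedKernelNorm_le_of_forall_le hC fun p s x => ?_
  -- the leg set and the fine prescription read by the leg sum at `(p, s)`
  set E : Finset (Fin (m + 1)) := univ.filter fun i => (Ωe i).isSome ∨ i = p with hE
  set τ'' : Fin (m + 1) → SectorLeg (sectorCount J') := fun i => (Ωe i).getD s with hτ''
  have hpE : p ∈ E := by simp [hE]
  have hEdom : ∀ i, (Ωe i).isSome → i ∈ E := fun i hi => by simp [hE, hi]
  have hFE : levelCount Ωe ≤ E.card := levelCount_le_card_legSet Ωe p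
  have hEF : E.card ≤ levelCount Ωe + 1 := card_legSet_le_levelCount_succ Ωe p
  have h27 : (0 : ℝ) < (27 : ℝ) ^ E.card := by positivity
  -- (1) the leg sum is dominated by the `E`-prescribed fine sum over `bgmSectorSet`
  have h1 : sectorLegSum ε (prescribedTuples (bgmSectorSet L M F' (m + 1)) Ωe) (sectorisedKernel L M β F' T (m + 1)) p s x ≤
      ε ^ m * ∑ σ'' ∈ (bgmSectorSet L M F' (m + 1)).filter (fun σ'' => ∀ e ∈ E, σ'' e = τ'' e),
        ∑ x'' ∈ univ.filter (fun x'' : Fin (m + 1) → SpaceTimeIdx L M => x'' p = x),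
          ‖sectorisedKernel L M β F' T (m + 1) σ'' x''‖ := by
    rw [sectorLegSum_def, ← mul_sum]
    refine mul_le_mul_of_nonneg_left (sum_le_sum_of_subset_of_nonneg ?_ fun _ _ _ => sum_nonneg fun _ _ => norm_nonneg _)
      (pow_nonneg hε0 m)
    intro Ω hΩ
    simp only [prescribedTuples, mem_filter] at hΩ ⊢
    refine ⟨hΩ.1.1, fun e he => ?_⟩
    have he' : (Ωe e).isSome ∨ e = p := by simpa [hE] using he
    rcases he' with he' | rfl
    · obtain ⟨ℓ, hℓ⟩ := Option.isSome_iff_exists.1 he'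
      rw [hτ'']
      simp only [hℓ, Option.getD_some]
      exact hΩ.1.2 e ℓ (by simp [hℓ])
    · show Ω e = (Ωe e).getD s
      rcases hcase : Ωe e with _ | ℓ
      · simpa using hΩ.2
      · simp only [Option.getD_some]
        exact hΩ.1.2 e ℓ (by simp [hcase])
  -- (2) the coarse `E`-prescribed sums over ALL tuples are dominated by the coarse levelled norms of the same level
  have hN₁ : ∀ (τ' : Fin (m + 1) → SectorLeg (sectorCount k)) (y : SpaceTimeIdx L M),
      ε ^ m * ∑ σ' ∈ univ.filter (fun σ' : Fin (m + 1) → SectorLeg (sectorCount k) => ∀ e ∈ E, σ' e = τ' e),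
        ∑ x' ∈ univ.filter (fun x' : Fin (m + 1) → SpaceTimeIdx L M => x' p = y),
          ‖sectorisedKernel L M β Fk T (m + 1) σ' x'‖ ≤ N := by
    intro τ' y
    have hlev : levelCount (fun i => (Ωe i).map fun _ => τ' i) = levelCount Ωe := levelCount_map_const Ωe τ'
    have hsub : (bgmSectorSet L M Fk (m + 1)).filter (fun σ' : Fin (m + 1) → SectorLeg (sectorCount k) => ∀ e ∈ E, σ' e = τ' e) ⊆
        univ.filter (fun σ' : Fin (m + 1) → SectorLeg (sectorCount k) => ∀ e ∈ E, σ' e = τ' e) :=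
      filter_subset_filter _ (subset_univ _)
    rw [← Finset.sum_subset hsub fun σ' hσ'univ hσ'not => ?_]
    · refine (sum_prescribed_le_sectorLegSum_prescribedTuples hε0 (sectorisedKernel L M β Fk T (m + 1)) _ Ωe p E hEdom hpE τ' y).trans ?_
      refine (sectorLegSum_le_sectorisedKernelNorm ε _ _ p (τ' p) y).trans ?_
      have h := hN _ hlev
      rwa [klLevNormOf, hubbardSectorKernelNorm_def] at h
    · have hP := (mem_filter.1 hσ'univ).2
      have hnot : σ' ∉ bgmSectorSet L M Fk (m + 1) := fun h => hσ'not (mem_filter.2 ⟨h, hP⟩)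
      exact sum_eq_zero fun x' _ => by rw [sectorisedKernel_eq_zero_of_not_mem_bgmSectorSet β Fk T hT hnot x', norm_zero]
  -- (3) the coarse `E`-prescribed sums over the class `B` are dominated by the coarse on-class norms of the same level
  have hN₂ : ∀ (τ' : Fin (m + 1) → SectorLeg (sectorCount k)) (y : SpaceTimeIdx L M),
      ε ^ m * ∑ σ' ∈ B.filter (fun σ' : Fin (m + 1) → SectorLeg (sectorCount k) => ∀ e ∈ E, σ' e = τ' e),
        ∑ x' ∈ univ.filter (fun x' : Fin (m + 1) → SpaceTimeIdx L M => x' p = y),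
          ‖sectorisedKernel L M β Fk T (m + 1) σ' x'‖ ≤ NB := by
    intro τ' y
    have hlev : levelCount (fun i => (Ωe i).map fun _ => τ' i) = levelCount Ωe := levelCount_map_const Ωe τ'
    refine (sum_prescribed_le_sectorLegSum_prescribedTuples hε0 (sectorisedKernel L M β Fk T (m + 1)) B Ωe p E hEdom hpE τ' y).trans ?_
    refine (sectorLegSum_le_sectorisedKernelNorm ε _ _ p (τ' p) y).trans ?_
    have h := hNB _ hlev
    rwa [hubbardSectorKernelNorm_def] at h
  -- (4) the re-sectorisation lemma with the class `B`
  have hR₁0 : 0 ≤ A₁ / (27 : ℝ) ^ E.card := div_nonneg hA₁ h27.le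
  have hR₂0 : 0 ≤ A₂ / (27 : ℝ) ^ E.card := div_nonneg hA₂ h27.le
  have h2 := hubbardSectorPrescribedSum_klAniso_jump_le_split (L := L) (M := M) hβ μ K hJ T hc₁0 hc₁r0 hR₁0 hR₂0 hN0 hNB0 hcol₁ hrow₁ m
    (bgmSectorSet L M F' (m + 1)) B E τ'' p hpE
    (fun σ' hσ' => by rw [le_div_iff₀ h27, mul_comm]; exact hRoff E τ'' σ' p hpE hσ' hFE hEF)
    (fun σ' hσ' => by rw [le_div_iff₀ h27, mul_comm]; exact hRon E τ'' σ' p hpE hσ' hFE hEF) hN₁ hN₂ x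
  -- (5) assemble
  refine h1.trans (h2.trans (le_of_eq ?_))
  field_simp
  ring

/-! ## §2 Count arithmetic off the class -/

omit [NeZero L] [NeZero M] in
/-- Off-class count arithmetic: for `|E| ≤ F + 1`, `2 ≤ m`, `0 ≤ D`: `27^{|E|}·(D^{m+1}·2^{Δ((m+1)−3)}) ≤ 27^{F+1}·D^{m+1}·(2^Δ)^{m−2}`. -/
theorem offClass_count_arith {D : ℝ} (hD : 0 ≤ D) (Δ m F e : ℕ) (hm : 2 ≤ m) (heF : e ≤ F + 1) :
    (27 : ℝ) ^ e * (D ^ (m + 1) * (2 : ℝ) ^ (Δ * ((m + 1) - 3))) ≤ (27 : ℝ) ^ (F + 1) * D ^ (m + 1) * ((2 : ℝ) ^ Δ) ^ (m - 2) := by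
  have hexp : (m + 1) - 3 = m - 2 := by omega
  rw [hexp, pow_mul, ← mul_assoc]
  exact mul_le_mul_of_nonneg_right (mul_le_mul_of_nonneg_right (pow_le_pow_right₀ (by norm_num) heF) (by positivity)) (by positivity)

/-! ## §3 The levelled jump, umklapp split, both counts discharged -/

/-- **THE LEVELLED JUMP, UMKLAPP SPLIT, BOTH COUNTS DISCHARGED** (the kit's `c₁`/`c₃`-row shape; `m + 1 ≥ 4` legs; class written out).
[cite: BenfattoGiulianiMastropietro2006, §2.8 (2.82)-(2.84), (2.88)-(2.90), App. A3] -/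
theorem klLevNormOf_jump_le_umklappSplit_klEng (m : ℕ) (hm : 3 ≤ m) :
    ∃ Cm : ℝ, 0 < Cm ∧ ∃ C : ℝ, 0 < C ∧ ∃ D₁ : ℝ, 0 < D₁ ∧ ∃ D₂ : ℝ, 0 < D₂ ∧ ∃ k₀ : ℕ,
      ∀ R : RenConsts, R.WF2 → ∃ c₃ : ℝ, 0 < c₃ ∧ ∃ U₀ : ℝ, 0 < U₀ ∧
      ∀ (P : SplitConsts) (c : ℝ), P.WF → 0 < c → c ≤ klEngC₃6 P R → c ≤ c₃ →
      ∀ μ ∈ klWindowC, ∀ U : ℝ, 0 < U → U ≤ klEngU₀9 P R c → U ≤ U₀ → ∀ β : ℝ, klBetaMin ≤ β → β ≤ Real.exp (c / U ^ 2) →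
      ∀ K : TrigPolyC4v, FrameOK R U (nScales β) μ K → ∀ (L M : ℕ) [NeZero L] [NeZero M],
      klEngL₃ β U ≤ L → klEngM₃ β U L ≤ M → ∀ k J' : ℕ, k₀ ≤ k → k + 1 ≤ J' → J' ≤ nScales β + 1 →
      ∀ T : HubbardGrassmann L M,
        (∀ (m' : ℕ) (X : Fin m' → HubbardFieldIdx L M), ∑ i, signedMomentum L (X i).2 (X i).1.1.2 ≠ 0 → kernel ℂ T m' X = 0) →
      ∀ (Ωe : Fin (m + 1) → Option (SectorLeg (sectorCount J'))) (N NB : ℝ), 0 ≤ N → 0 ≤ NB →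
        (∀ Ωe' : Fin (m + 1) → Option (SectorLeg (sectorCount k)), levelCount Ωe' = levelCount Ωe →
          klLevNormOf L M β μ K k (m + 1) T Ωe' ≤ N) →
        (∀ Ωe' : Fin (m + 1) → Option (SectorLeg (sectorCount k)), levelCount Ωe' = levelCount Ωe →
          hubbardSectorKernelNorm L M β (klAnisoFamily L M β μ K klE0 k)
            (prescribedTuples (univ.filter fun σ' : Fin (m + 1) → SectorLeg (sectorCount k) =>
              ¬ ∀ G : Fin 2 → ℤ, G ≠ 0 → ∃ j : Fin 2, ((m : ℝ) + 1) * C * sectorWidth k <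
                |∑ i, (if (σ' i).2 = 0 then klFermiPoint μ K (sectorCenter k (σ' i).1.1) j
                    else -klFermiPoint μ K (sectorCenter k (σ' i).1.1) j) - 2 * π * (G j : ℝ)|) Ωe') T ≤ NB) →
        klLevNormOf L M β μ K J' (m + 1) T Ωe ≤
          Cm * ((27 : ℝ) ^ (levelCount Ωe + 1) * D₁ ^ (m + 1) * ((2 : ℝ) ^ (J' - k)) ^ (m - 2) * N +
            D₂ * 27 ^ (m + 1) * ((2 : ℝ) ^ (J' - k)) ^ (m - levelCount Ωe) * NB) := by
  obtain ⟨CJ, hCJ, hov⟩ := overlap_jump_sums_klEng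
  obtain ⟨C, hC, D₁, hD₁, k₀, hoff⟩ := card_relCount_prescribed_offUmklapp_klAniso_le_window
  obtain ⟨D₂, hD₂, hon⟩ := card_relCount_prescribed_lastLeg_klAniso_le_window m
  refine ⟨(3 * CJ / 2) ^ (m + 1), by positivity, C, hC, D₁, hD₁, D₂, hD₂, k₀, fun R hR2 => ?_⟩
  have hRj : ∀ j, 0 ≤ R.Gfr j := gfr_nonneg_of_wf2 hR2
  obtain ⟨c₃, hc₃, U₀, hU₀, hoff'⟩ := hoff R hRj
  obtain ⟨c₃', hc₃', U₀', hU₀', hon'⟩ := hon R hRj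
  refine ⟨min c₃ c₃', lt_min hc₃ hc₃', min U₀ U₀', lt_min hU₀ hU₀', ?_⟩
  intro P c hP hc hc6 hcm μ hμ U hU hU9 hUm β hβmin hβc K hK L M _ _ hL3 hM3 k J' hk₀ hJ hJN T hT Ωe N NB hN0 hNB0 hN hNB
  have hβ : 0 < β := KLRegimeSplit.pos_of_klBetaMin_le hβmin
  have hkJ : k ≤ J' := by omega
  obtain ⟨_, hcol₁, hrow₁⟩ := hov P R c hP hR2 hc hc6 μ hμ U hU hU9 β hβmin hβc K hK L M hL3 hM3 k J' hJ hJN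
  have hc₁0 : (0 : ℝ) ≤ 3 * CJ * M / β := by positivity
  set B : Finset (Fin (m + 1) → SectorLeg (sectorCount k)) := univ.filter fun σ' : Fin (m + 1) → SectorLeg (sectorCount k) =>
    ¬ ∀ G : Fin 2 → ℤ, G ≠ 0 → ∃ j : Fin 2, ((m : ℝ) + 1) * C * sectorWidth k <
      |∑ i, (if (σ' i).2 = 0 then klFermiPoint μ K (sectorCenter k (σ' i).1.1) j
          else -klFermiPoint μ K (sectorCenter k (σ' i).1.1) j) - 2 * π * (G j : ℝ)| with hB
  have hA₁ : (0 : ℝ) ≤ (27 : ℝ) ^ (levelCount Ωe + 1) * D₁ ^ (m + 1) * ((2 : ℝ) ^ (J' - k)) ^ (m - 2) := by positivity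
  have hA₂ : (0 : ℝ) ≤ D₂ * 27 ^ (m + 1) * ((2 : ℝ) ^ (J' - k)) ^ (m - levelCount Ωe) := by positivity
  have h := klLevNormOf_jump_le_split_of_consts_pinned hβ μ K hJ T hT hc₁0 hc₁0 hcol₁ hrow₁ m B Ωe hA₁ hA₂ hN0 hNB0
    (fun E τ'' σ' p hp hσ' hFE hEF => ?_) (fun E τ'' σ' p hp _ hFE hEF => ?_) hN hNB
  · have hMne : (M : ℝ) ≠ 0 := by exact_mod_cast NeZero.ne M
    have hεc : imagTimeWeight β M * (3 * CJ * M / β) = 3 * CJ / 2 := by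
      unfold imagTimeWeight; field_simp
    have hconst : (3 * CJ * M / β) ^ m * (3 * CJ * M / β) * imagTimeWeight β M ^ (m + 1) = (3 * CJ / 2) ^ (m + 1) := by
      rw [← pow_succ, ← mul_pow, mul_comm (3 * CJ * M / β), hεc]
    calc klLevNormOf L M β μ K J' (m + 1) T Ωe
        ≤ (3 * CJ * M / β) ^ m * (3 * CJ * M / β) * imagTimeWeight β M ^ (m + 1) *
            ((27 : ℝ) ^ (levelCount Ωe + 1) * D₁ ^ (m + 1) * ((2 : ℝ) ^ (J' - k)) ^ (m - 2) * N +
              D₂ * 27 ^ (m + 1) * ((2 : ℝ) ^ (J' - k)) ^ (m - levelCount Ωe) * NB) := h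
      _ = (3 * CJ / 2) ^ (m + 1) * ((27 : ℝ) ^ (levelCount Ωe + 1) * D₁ ^ (m + 1) * ((2 : ℝ) ^ (J' - k)) ^ (m - 2) * N +
              D₂ * 27 ^ (m + 1) * ((2 : ℝ) ^ (J' - k)) ^ (m - levelCount Ωe) * NB) := by rw [hconst]
  · -- off the class: the second-determined-leg count
    have hoffσ : ∀ G : Fin 2 → ℤ, G ≠ 0 → ∃ j : Fin 2, ((m : ℝ) + 1) * C * sectorWidth k <
        |∑ i, (if (σ' i).2 = 0 then klFermiPoint μ K (sectorCenter k (σ' i).1.1) j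
            else -klFermiPoint μ K (sectorCenter k (σ' i).1.1) j) - 2 * π * (G j : ℝ)| := by
      by_contra hno
      exact hσ' (by simp only [hB, mem_filter, mem_univ, true_and]; exact hno)
    have hcnt := hoff' c hc (hcm.trans (min_le_left _ _)) U hU (hUm.trans (min_le_left _ _)) β hβmin hβc μ hμ μ K hK L M m k J' hk₀ hkJ hm
      _ subset_rfl E τ'' p hp σ' hoffσ
    exact (mul_le_mul_of_nonneg_left hcnt (by positivity)).trans (offClass_count_arith hD₁.le (J' - k) m (levelCount Ωe) E.card (by omega) hEF)
  · -- on the class: the one-determined-leg count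
    have hcnt := hon' c hc (hcm.trans (min_le_right _ _)) U hU (hUm.trans (min_le_right _ _)) β hβmin hβc μ hμ μ K hK L M k J' hkJ _ subset_rfl E τ'' σ'
    exact (mul_le_mul_of_nonneg_left hcnt (by positivity)).trans
      (legSet_count_arith hD₂.le (J' - k) m (levelCount Ωe) E.card hFE ((card_le_univ _).trans_eq (Fintype.card_fin _)))

/-! ## §4 The weighted jump at the flow frame, umklapp split, both counts discharged -/

/-- **THE WEIGHTED JUMP AT THE FLOW FRAME (deep window), UMKLAPP SPLIT, BOTH COUNTS DISCHARGED** (`m + 1 ≥ 4` legs; every rate `j ≥ J′`).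
[cite: BenfattoGiulianiMastropietro2006, §2.8 (2.82)-(2.84), (2.88)-(2.90), App. A3] -/
theorem klWtPinnedSumAt_jump_le_umklappSplit_klEng_flow_deep (dd m : ℕ) (hm : 3 ≤ m) :
    ∃ Cm : ℝ, 0 < Cm ∧ ∃ C : ℝ, 0 < C ∧ ∃ D₁ : ℝ, 0 < D₁ ∧ ∃ D₂ : ℝ, 0 < D₂ ∧ ∃ k₀ : ℕ,
      ∀ R : RenConsts, R.WF2 → ∃ c₃ : ℝ, 0 < c₃ ∧ ∃ U₀ : ℝ, 0 < U₀ ∧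
      ∀ (G : GeoConsts) (P : SplitConsts) (Q : EngConsts) (cc : ℝ), 0 < cc → cc ≤ klEngC₃6 P R → cc ≤ c₃ →
      ∀ μ ∈ klWindowC, ∀ U : ℝ, 0 < U → U ≤ min (klEngU₀3 P R cc) (1 / (R.Gfr 3 + 1)) → U ≤ U₀ →
      ∀ β : ℝ, klBetaMin ≤ β → β ≤ Real.exp (cc / U ^ 2) →
      ∀ (L M : ℕ) [NeZero L] [NeZero M], klEngL₃ β U ≤ L → klEngM₃ β U L ≤ M →
      ∀ n : ℕ, 1 ≤ n → n ≤ nScales β + 1 →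
        HistP klPredsV17F2 L M G P Q R β U μ 0 n → FrameOK R U (nScales β) μ (klFlowFrameU L M β U μ n) →
        ∀ k J' : ℕ, k₀ ≤ k → k + 1 ≤ J' → J' ≤ n → (4 : ℝ) ^ n * U ≤ (4 : ℝ) ^ (2 * (k + 1) + dd) →
        ∀ T : HubbardGrassmann L M,
          (∀ (m' : ℕ) (X : Fin m' → HubbardFieldIdx L M), ∑ i, signedMomentum L (X i).2 (X i).1.1.2 ≠ 0 → kernel ℂ T m' X = 0) →
        ∀ j : ℕ, J' ≤ j → ∀ (q : Fin (m + 1)) (w : SpaceTimeIdx L M × SectorLeg (sectorCount J')) (N NB : ℝ), 0 ≤ N → 0 ≤ NB →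
          (∀ w' : SpaceTimeIdx L M × SectorLeg (sectorCount k),
            klWtPinnedSumAt L M β μ (klFlowFrameU L M β U μ n) k j (m + 1) T q w' ≤ N) →
          (∀ (ℓ' : SectorLeg (sectorCount k)) (y' : SpaceTimeIdx L M),
            imagTimeWeight β M ^ m *
              ∑ σ' ∈ (univ.filter fun σ' : Fin (m + 1) → SectorLeg (sectorCount k) =>
                  ¬ ∀ G : Fin 2 → ℤ, G ≠ 0 → ∃ j : Fin 2, ((m : ℝ) + 1) * C * sectorWidth k <
                    |∑ i, (if (σ' i).2 = 0 then klFermiPoint μ (klFlowFrameU L M β U μ n) (sectorCenter k (σ' i).1.1) j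
                        else -klFermiPoint μ (klFlowFrameU L M β U μ n) (sectorCenter k (σ' i).1.1) j) - 2 * π * (G j : ℝ)|).filter
                (fun σ' : Fin (m + 1) → SectorLeg (sectorCount k) => σ' q = ℓ'),
              ∑ x' ∈ univ.filter (fun x' : Fin (m + 1) → SpaceTimeIdx L M => x' q = y'),
                klScaleWt L M β j ((univ.image x').image (fun x : SpaceTimeIdx L M => (((((2 * (x.1 : ℕ) : ℕ)) : ZMod (2 * (2 * M)))), x.2))) *
                  ‖sectorisedKernel L M β (klAnisoFamily L M β μ (klFlowFrameU L M β U μ n) klE0 k) T (m + 1) σ' x'‖ ≤ NB) →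
          klWtPinnedSumAt L M β μ (klFlowFrameU L M β U μ n) J' j (m + 1) T q w ≤
            Cm * ((27 : ℝ) * D₁ ^ (m + 1) * ((2 : ℝ) ^ (J' - k)) ^ (m - 2) * N + D₂ * 27 ^ (m + 1) * ((2 : ℝ) ^ (J' - k)) ^ (m - 1) * NB) := by
  obtain ⟨Cm, hCm, hsplit⟩ := klWtPinnedSumAt_jump_le_split_klEng_flow_deep dd m
  obtain ⟨C, hC, D₁, hD₁, k₀, hoff⟩ := card_relCount_prescribed_offUmklapp_klAniso_le_window
  obtain ⟨D₂, hD₂, hon⟩ := card_relCount_prescribed_lastLeg_klAniso_le_window m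
  refine ⟨Cm, hCm, C, hC, D₁, hD₁, D₂, hD₂, k₀, fun R hR2 => ?_⟩
  have hRj : ∀ j, 0 ≤ R.Gfr j := gfr_nonneg_of_wf2 hR2
  obtain ⟨c₃, hc₃, U₀, hU₀, hoff'⟩ := hoff R hRj
  obtain ⟨c₃', hc₃', U₀', hU₀', hon'⟩ := hon R hRj
  refine ⟨min c₃ c₃', lt_min hc₃ hc₃', min U₀ U₀', lt_min hU₀ hU₀', ?_⟩
  intro G P Q cc hcc hcc6 hccm μ hμ U hU hUle hUm β hβmin hβc L M _ _ hL3 hM3 n hn1 hnN hhist hfr k J' hk₀ hJ hJn hwin T hT j hjJ q w N NB hN0 hNB0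
    hN hNB
  have hkJ : k ≤ J' := by omega
  set K : TrigPolyC4v := klFlowFrameU L M β U μ n with hK
  set B : Finset (Fin (m + 1) → SectorLeg (sectorCount k)) := univ.filter fun σ' : Fin (m + 1) → SectorLeg (sectorCount k) =>
    ¬ ∀ G : Fin 2 → ℤ, G ≠ 0 → ∃ j : Fin 2, ((m : ℝ) + 1) * C * sectorWidth k <
      |∑ i, (if (σ' i).2 = 0 then klFermiPoint μ K (sectorCenter k (σ' i).1.1) j
          else -klFermiPoint μ K (sectorCenter k (σ' i).1.1) j) - 2 * π * (G j : ℝ)| with hB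
  have hA₁ : (0 : ℝ) ≤ (27 : ℝ) * D₁ ^ (m + 1) * ((2 : ℝ) ^ (J' - k)) ^ (m - 2) := by positivity
  have hA₂ : (0 : ℝ) ≤ D₂ * 27 ^ (m + 1) * ((2 : ℝ) ^ (J' - k)) ^ (m - 1) := by positivity
  refine hsplit G P R Q cc hR2 hcc hcc6 μ hμ U hU hUle β hβmin hβc L M hL3 hM3 n hn1 hnN hhist hfr k J' hJ hJn hwin T hT j hjJ B q w _ _ N NB
    hA₁ hA₂ hN0 hNB0 (fun ℓ'' σ' hσ' => ?_) (fun ℓ'' σ' _ => ?_) hN hNB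
  · have hoffσ : ∀ G : Fin 2 → ℤ, G ≠ 0 → ∃ j : Fin 2, ((m : ℝ) + 1) * C * sectorWidth k <
        |∑ i, (if (σ' i).2 = 0 then klFermiPoint μ K (sectorCenter k (σ' i).1.1) j
            else -klFermiPoint μ K (sectorCenter k (σ' i).1.1) j) - 2 * π * (G j : ℝ)| := by
      by_contra hno
      exact hσ' (by simp only [hB, mem_filter, mem_univ, true_and]; exact hno)
    have hcnt := hoff' cc hcc (hccm.trans (min_le_left _ _)) U hU (hUm.trans (min_le_left _ _)) β hβmin hβc μ hμ μ K hfr L M m k J' hk₀ hkJ hm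
      _ subset_rfl ({q} : Finset (Fin (m + 1))) (fun _ => ℓ'') q (mem_singleton_self _) σ' hoffσ
    have h1 := offClass_count_arith hD₁.le (J' - k) m 0 1 (by omega) (by omega)
    simp only [pow_one, zero_add] at h1
    exact (mul_le_mul_of_nonneg_left hcnt (by norm_num)).trans h1
  · have hcnt := hon' cc hcc (hccm.trans (min_le_right _ _)) U hU (hUm.trans (min_le_right _ _)) β hβmin hβc μ hμ μ K hfr L M k J' hkJ _ subset_rfl
      ({q} : Finset (Fin (m + 1))) (fun _ => ℓ'') σ'
    have h1 := legSet_count_arith hD₂.le (J' - k) m 1 1 le_rfl (by omega)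
    rw [card_singleton] at hcnt
    rw [pow_one] at h1
    exact (mul_le_mul_of_nonneg_left hcnt (by norm_num)).trans h1

end Summit.HubbardSuperconductivity.HubbardSuperconductivity.Theorems.EngineV8

end
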